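import Summits.BirchSwinnertonDyer.BirchSwinnertonDyer.Theorems.KimAtThreeDeepLowerOffStratumLevelLoweringMultiStabConditionOne
import Summits.BirchSwinnertonDyer.BirchSwinnertonDyer.Theorems.KimAtThreeDeepLowerOffStratumLevelLoweringDoubleStabData
import Summits.BirchSwinnertonDyer.BirchSwinnertonDyer.Theorems.KimAtThreeDeepLowerOffStratumLevelLoweringStabCanonicalPeriod
import Literature.NumberTheory.EllipticCurves.HeckePolynomialSimpleRootsWeightTwo
import HarnessLib

/-!
# Route `KimAtThreeKolyvagin` (rung W2), crux `DeepLowerAtThreeOffKatoStratum` (item 19679), registered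
# stub `stub_nonAdditive`, ROAD (b^k): the `k`-FOLD STABILISATION of the optimal-level newform at a squarefree
# set of primes `D` — existence of the comparison form `G ∈ S₂(Γ₀(M₀D))` with all its Vatsal data (induction on `D`)

Cell `bsd-addord`, seat `bsd-addord-w2-acc2`, gen 6; item `stmt-BirchSwinnertonDyer-19679` (`--supports`, closes
nothing). ROAD (b^k) file 4. For a newform `g ∈ S₂(Γ₀(M₀))`, a squarefree `D` prime to `M₀`, and at each prime
`p ∣ D` a sign `u_p = ±1` (the value `a_p(f_E)` of the curve's newform at a multiplicative prime where `ρ̄_{E,3}`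
is unramified) with `a_p(g) ≡ u_p(p + 1)`, THIS FILE builds by induction on `D` — one prime at a time, through
`…MultiStabConditionOne` (Condition 1), `…StabEigenform` (eigenform / normalised / integral / number field /
prime coefficients) and `…DoubleStabData` §1 (the root `β ≡ u_p p`), with `α ≠ β` from Coleman–Edixhoven BY NAME —
a normalised Hecke eigenform `G ∈ S₂(Γ₀(M₀D))` with: `3`-integral coefficients in a number field, Vatsal's
Condition 1, `a_p(G) = a_p(g)` for `p ∤ D`, `a_p(G) ≡ u_p` for `p ∣ D`, and `G` in the complex span of the
REAL-coefficient forms on which every `T_r` (`r ∤ M₀D`) acts by `a_r(g)` (the real structure consumed by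
`…MultiStabPeriod` / `…MultiStabIhara`). The level is carried as a free variable `L = M₀·D` so that the induction
never transports cusp forms along equalities of levels. Theorems only; no definition, no fact, no `sorry`.

* §1 `iota_mem_span_realEigen` — `ι₁`, `ι_ℓ` preserve the real eigen-structure.
* §2 ★ `exists_multiStab` — the induction.

## References

* F. Diamond, J. Shurman (2005), §5.7, Prop. 5.6.2, Prop. 5.8.5 [DiamondShurman2005]; V. Vatsal, Duke Math. J. 98
  (1999), (1.2) Condition 1 [Vatsal1999]; R. F. Coleman, B. Edixhoven, Math. Ann. 310 (1998), Thm. 2.1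
  [ColemanEdixhoven1998]; G. Shimura (1971), Thm. 3.48 [Shimura1971].
-/

set_option autoImplicit false
-- the Theorems namespace of a single-conjunct summit repeats the summit name by design (D-0017)
set_option linter.dupNamespace false

noncomputable section

open scoped MatrixGroups ModularForm Classical NNReal

open CongruenceSubgroup WeierstrassCurve Literature.NumberTheory.EllipticCurves
  Literature.NumberTheory.EllipticCurves.ModularForms
open UpperHalfPlane hiding I

namespace Summit.BirchSwinnertonDyer.BirchSwinnertonDyer.Theorems.KimAtThreeDeepLowerOffStratumLevelLoweringMultiStabData

open Summit.BirchSwinnertonDyer.BirchSwinnertonDyer.Theorems.KimAtThreeDeepLowerOffStratumLevelLoweringConditionOne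
open Summit.BirchSwinnertonDyer.BirchSwinnertonDyer.Theorems.KimAtThreeDeepLowerOffStratumLevelLoweringVatsalStab
  (cuspCoeff_stab isNormalized_stab)
open Summit.BirchSwinnertonDyer.BirchSwinnertonDyer.Theorems.KimAtThreeDeepLowerOffStratumLevelLoweringVatsalStabRows
  (valuation_cuspCoeff_le_one_of_isNewform0)
open Summit.BirchSwinnertonDyer.BirchSwinnertonDyer.Theorems.KimAtThreeDeepLowerOffStratumLevelLoweringStabEigenform
  renaming heckeT_stab_of_ne → heckeT_stab_of_ne_eig, heckeT_stab_self → heckeT_stab_self_eig,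
    isHeckeEigenform_stab → isHeckeEigenform_stab_eig, cuspCoeff_stab_prime → cuspCoeff_stab_prime_eig,
    cuspCoeff_mul_cuspCoeff → cuspCoeff_mul_cuspCoeff_eig, heckeEigenvalue_stab → heckeEigenvalue_stab_eig,
    valuation_cuspCoeff_stab_le_one → valuation_cuspCoeff_stab_le_one_eig,
    finiteDimensional_coeffField_stab → finiteDimensional_coeffField_stab_eig
open Summit.BirchSwinnertonDyer.BirchSwinnertonDyer.Theorems.KimAtThreeDeepLowerOffStratumLevelLoweringDoubleStabData
  (exists_root_valuation_sub_lt_one_sign)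
open Summit.BirchSwinnertonDyer.BirchSwinnertonDyer.Theorems.KimAtThreeDeepLowerOffStratumLevelLoweringStabCanonicalPeriod
  (cuspCoeff_iota_im_eq_zero)
open Summit.BirchSwinnertonDyer.BirchSwinnertonDyer.Theorems.KimAtThreeDeepLowerOffStratumLevelLoweringMultiStabConditionOne

/-! ### §1 The degeneracy maps preserve the real eigen-structure -/

section Real

variable {L ℓ : ℕ} [NeZero L] [NeZero ℓ] (a : ℕ → ℂ)

/-- **`ι_d` (`d ∈ {1, ℓ}`, `ℓ` prime) maps a real-coefficient form on which `T_r` (`r ∤ L`) acts by `a(r)` to a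
real-coefficient form of level `Lℓ` on which `T_r` (`r ∤ Lℓ`) acts by `a(r)`** (`T_r ι_d = ι_d T_r`,
Diamond–Shurman Prop. 5.6.2). [cite: DiamondShurman2005, Prop. 5.6.2 (proof, first diagram)] -/
theorem iota_mem_span_realEigen (hℓ : ℓ.Prime) {d : ℕ} [NeZero d] (hd : L * d ∣ L * ℓ) (hdℓ : d = 1 ∨ d = ℓ)
    {ψ : CuspForm (Gamma0 L) 2} (hreal : ∀ m, (cuspCoeff ψ m).im = 0)
    (hT : ∀ (r : ℕ) (hr : r.Prime), ¬ r ∣ L → (haveI : NeZero r := ⟨hr.ne_zero⟩; heckeT (Gamma0 L) 2 r ψ) = a r • ψ) :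
    iota L (L * ℓ) d 2 hd ψ ∈ Submodule.span ℂ {ψ' : CuspForm (Gamma0 (L * ℓ)) 2 | (∀ m, (cuspCoeff ψ' m).im = 0) ∧
      ∀ (r : ℕ) (hr : r.Prime), ¬ r ∣ L * ℓ →
        (haveI : NeZero r := ⟨hr.ne_zero⟩; heckeT (Gamma0 (L * ℓ)) 2 r ψ') = a r • ψ'} := by
  refine Submodule.subset_span ⟨cuspCoeff_iota_im_eq_zero ψ hreal hd, fun r hr hrL ↦ ?_⟩
  haveI : NeZero r := ⟨hr.ne_zero⟩
  have hrL' : ¬ r ∣ L := fun h ↦ hrL (h.mul_right ℓ)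
  have hrℓ : ¬ r ∣ ℓ := fun h ↦ hrL (h.mul_left L)
  have hrd : ¬ r ∣ d := by
    rcases hdℓ with rfl | rfl
    · exact hr.not_dvd_one
    · exact hrℓ
  rw [heckeT_iota_of_not_dvd hd hr hrd ⟨fun h ↦ absurd h hrL', fun h ↦ absurd h hrL⟩, hT r hr hrL', map_smul]

end Real

/-! ### §2 The `k`-fold stabilisation: induction on the squarefree set of primes `D` -/

section Induction

variable {M₀ : ℕ} [NeZero M₀] {g : CuspForm (Gamma0 M₀) 2} (hg : IsNewform0 g) (ι : PadicAlgCl 3 ≃+* ℂ)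
  (af : ℕ → ℂ)
include hg

/-- ★ **THE `k`-FOLD STABILISATION of the optimal-level newform.** Let `g ∈ S₂(Γ₀(M₀))` be a newform, `D`
squarefree and prime to `M₀`, and suppose that at every prime `p ∣ D` there is a sign `u_p = ±1` with `af p = u_p`
and `a_p(g) ≡ u_p (p + 1)` (mod `𝔪`, through `ι⁻¹`). Then (Coleman–Edixhoven BY NAME for `α ≠ β`) at level
`L = M₀ D` there is a normalised Hecke eigenform `G` with `3`-integral coefficients in a number field, satisfying
Vatsal's Condition 1, `a_p(G) = a_p(g)` for primes `p ∤ D`, `a_p(G) ≡ af p` for primes `p ∣ D`, lying in the complex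
span of the real-coefficient forms of level `L` on which every `T_r`, `r ∤ L`, acts by `a_r(g)`: the iterated
stabilisation `(∏_{p ∣ D} (ι₁ − β_p ι_p)) g`, `β_p ≡ u_p p`, built one prime at a time.
[cite: Vatsal1999, (1.2) Condition 1] [cite: ColemanEdixhoven1998, Thm. 2.1] [cite: DiamondShurman2005, §5.7 and Prop. 5.6.2]
[cite: Shimura1971, Thm. 3.48] -/
theorem exists_multiStab (hCE : colemanEdixhoven1998_heckePolynomial_simpleRoots) :
    ∀ (D : ℕ), Squarefree D → Nat.Coprime D M₀ →
      (∀ p : ℕ, p.Prime → p ∣ D → ∃ u : ℤ, u * u = 1 ∧ af p = u ∧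
        Valued.v (ι.symm (cuspCoeff g p - u * (p + 1))) < 1) →
      ∀ (L : ℕ) [NeZero L], L = M₀ * D →
        ∃ G : CuspForm (Gamma0 L) 2,
          IsHeckeEigenform G ∧ IsNormalized G ∧ (∀ n : ℕ, Valued.v (ι.symm (cuspCoeff G n)) ≤ 1) ∧
          FiniteDimensional ℚ (coeffField G) ∧ HasSimpleHeckeGenEigenspace G ∧
          (∀ p : ℕ, p.Prime → ¬ p ∣ D → cuspCoeff G p = cuspCoeff g p) ∧
          (∀ p : ℕ, p.Prime → p ∣ D → Valued.v (ι.symm (af p - cuspCoeff G p)) < 1) ∧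
          G ∈ Submodule.span ℂ {ψ : CuspForm (Gamma0 L) 2 | (∀ m, (cuspCoeff ψ m).im = 0) ∧
            ∀ (r : ℕ) (hr : r.Prime), ¬ r ∣ L →
              (haveI : NeZero r := ⟨hr.ne_zero⟩; heckeT (Gamma0 L) 2 r ψ) = cuspCoeff g r • ψ} := by
  intro D
  induction D using Nat.strong_induction_on with
  | _ D ih =>
    intro hDsq hDM₀ hDat L _ hL
    by_cases hD1 : D = 1
    · -- base: `D = 1`, `G = g`
      subst hD1
      obtain rfl : L = M₀ := by rw [hL, mul_one]
      refine ⟨g, hg.2.1, hg.2.2, valuation_cuspCoeff_le_one_of_isNewform0 hg ι,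
        IsNewform0.finiteDimensional_coeffField_holds hg, hasSimpleHeckeGenEigenspace_of_isNewform0 hg,
        fun p _ _ ↦ rfl, fun p hp hp1 ↦ absurd (Nat.eq_one_of_dvd_one hp1) hp.ne_one, ?_⟩
      refine Submodule.subset_span ⟨hg.cuspCoeff_im_eq_zero, fun r hr _ ↦ ?_⟩
      haveI : NeZero r := ⟨hr.ne_zero⟩
      exact hg.heckeT_eq_coeff_smul hr
    · -- step: `D = ℓ D'` with `ℓ` prime, `ℓ ∤ D'`
      obtain ⟨ℓ, hℓ, hℓD⟩ := Nat.exists_prime_and_dvd hD1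
      obtain ⟨D', rfl⟩ := hℓD
      have hsq := Nat.squarefree_mul_iff.mp hDsq
      obtain ⟨hℓD', -, hD'sq⟩ := hsq
      have hℓD'' : ¬ ℓ ∣ D' := fun h ↦ hℓ.ne_one (Nat.Coprime.eq_one_of_dvd hℓD' h)
      have hD'M₀ : Nat.Coprime D' M₀ := Nat.Coprime.coprime_dvd_left (dvd_mul_left D' ℓ) hDM₀
      have hℓM₀ : ¬ ℓ ∣ M₀ := fun h ↦
        hℓ.ne_one (Nat.Coprime.eq_one_of_dvd (Nat.Coprime.coprime_dvd_left (dvd_mul_right ℓ D') hDM₀) h)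
      have hD'0 : D' ≠ 0 := Squarefree.ne_zero hD'sq
      haveI : NeZero D' := ⟨hD'0⟩
      haveI : NeZero ℓ := ⟨hℓ.ne_zero⟩
      have hD'lt : D' < ℓ * D' := by
        have := hℓ.two_le
        have hpos := Nat.pos_of_ne_zero hD'0
        nlinarith
      -- the form at level `M₀ D'`
      obtain ⟨G', hG'eig, hG'norm, hG'int, hG'fd, hG'C, hG'g, hG'f, hG'span⟩ :=
        ih D' hD'lt hD'sq hD'M₀ (fun p hp hpD' ↦ hDat p hp (hpD'.mul_left ℓ)) (M₀ * D') rfl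
      have hℓL' : ¬ ℓ ∣ M₀ * D' := by
        intro h
        rcases (Nat.Prime.dvd_mul hℓ).mp h with h | h
        · exact hℓM₀ h
        · exact hℓD'' h
      have hM₀L' : M₀ ∣ M₀ * D' := dvd_mul_right M₀ D'
      have h1 : M₀ * D' * 1 ∣ M₀ * D' * ℓ := mul_dvd_mul_left _ (one_dvd ℓ)
      have hℓℓ : M₀ * D' * ℓ ∣ M₀ * D' * ℓ := dvd_rfl
      -- the root `β ≡ uℓ` and `α ≠ β`
      obtain ⟨u, hu, hafℓ, haℓ⟩ := hDat ℓ hℓ (dvd_mul_right ℓ D')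
      have hGℓ : cuspCoeff G' ℓ = cuspCoeff g ℓ := hG'g ℓ hℓ hℓD''
      rw [← hGℓ] at haℓ
      obtain ⟨β, hβ, -, hα⟩ := exists_root_valuation_sub_lt_one_sign ι (hG'int ℓ) ℓ hu haℓ
      have hne : cuspCoeff G' ℓ - β ≠ β :=
        colemanEdixhoven1998_heckePolynomial_simpleRoots.root_ne hCE hg hℓ hℓM₀
          (by rw [← hGℓ]; exact sub_add_cancel _ β) (by linear_combination -hβ)
      -- the data of the new form `G = ι₁ G' − β ι_ℓ G'` at level `M₀ D' ℓ = L`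
      have hGeig : IsHeckeEigenform (iota (M₀ * D') (M₀ * D' * ℓ) 1 2 h1 G' - β • iota (M₀ * D') (M₀ * D' * ℓ) ℓ 2 hℓℓ G') :=
        isHeckeEigenform_stab_eig hG'eig hG'norm β h1 hℓℓ hℓ hℓL' hβ
      have hGnorm : IsNormalized (iota (M₀ * D') (M₀ * D' * ℓ) 1 2 h1 G' - β • iota (M₀ * D') (M₀ * D' * ℓ) ℓ 2 hℓℓ G') :=
        isNormalized_stab G' β h1 hℓℓ hG'norm hℓ
      have hGint : ∀ n : ℕ, Valued.v (ι.symm (cuspCoeff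
          (iota (M₀ * D') (M₀ * D' * ℓ) 1 2 h1 G' - β • iota (M₀ * D') (M₀ * D' * ℓ) ℓ 2 hℓℓ G') n)) ≤ 1 :=
        valuation_cuspCoeff_stab_le_one_eig ι β h1 hℓℓ hG'int hβ
      have hGfd : FiniteDimensional ℚ
          (coeffField (iota (M₀ * D') (M₀ * D' * ℓ) 1 2 h1 G' - β • iota (M₀ * D') (M₀ * D' * ℓ) ℓ 2 hℓℓ G')) :=
        finiteDimensional_coeffField_stab_eig β h1 hℓℓ hG'fd hβ
      have hGC : HasSimpleHeckeGenEigenspace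
          (iota (M₀ * D') (M₀ * D' * ℓ) 1 2 h1 G' - β • iota (M₀ * D') (M₀ * D' * ℓ) ℓ 2 hℓℓ G') :=
        hasSimpleHeckeGenEigenspace_stab_of_hasSimpleHeckeGenEigenspace hg h1 hℓℓ hM₀L' hG'eig hG'norm hG'C
          (fun p hp hpL' ↦ hG'g p hp fun h ↦ hpL' (h.mul_left M₀)) hℓ hℓL' hβ hne
      have hGp : ∀ {p : ℕ}, p.Prime →
          cuspCoeff (iota (M₀ * D') (M₀ * D' * ℓ) 1 2 h1 G' - β • iota (M₀ * D') (M₀ * D' * ℓ) ℓ 2 hℓℓ G') p =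
            if p = ℓ then cuspCoeff G' ℓ - β else cuspCoeff G' p :=
        fun hp ↦ cuspCoeff_stab_prime_eig hG'norm β h1 hℓℓ hℓ hp
      have hGspan : ∀ {d : ℕ} [NeZero d] (hd : M₀ * D' * d ∣ M₀ * D' * ℓ), d = 1 ∨ d = ℓ →
          iota (M₀ * D') (M₀ * D' * ℓ) d 2 hd G' ∈ Submodule.span ℂ {ψ' : CuspForm (Gamma0 (M₀ * D' * ℓ)) 2 |
            (∀ m, (cuspCoeff ψ' m).im = 0) ∧ ∀ (r : ℕ) (hr : r.Prime), ¬ r ∣ M₀ * D' * ℓ →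
              (haveI : NeZero r := ⟨hr.ne_zero⟩; heckeT (Gamma0 (M₀ * D' * ℓ)) 2 r ψ') = cuspCoeff g r • ψ'} := by
        intro d _ hd hdℓ
        refine (Submodule.map_span_le (iota (M₀ * D') (M₀ * D' * ℓ) d 2 hd) _ _ |>.mpr ?_)
          (Submodule.mem_map_of_mem hG'span)
        rintro ψ ⟨hreal, hT⟩
        exact iota_mem_span_realEigen (fun r ↦ cuspCoeff g r) hℓ hd hdℓ hreal hT
      obtain rfl : L = M₀ * D' * ℓ := by rw [hL]; ring
      refine ⟨iota (M₀ * D') (M₀ * D' * ℓ) 1 2 h1 G' - β • iota (M₀ * D') (M₀ * D' * ℓ) ℓ 2 hℓℓ G',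
        hGeig, hGnorm, hGint, hGfd, hGC, fun p hp hpD ↦ ?_, fun p hp hpD ↦ ?_,
        Submodule.sub_mem _ (hGspan h1 (Or.inl rfl)) (Submodule.smul_mem _ _ (hGspan hℓℓ (Or.inr rfl)))⟩
      · -- `a_p(G) = a_p(g)` off `D = ℓ D'`
        have hpℓ : p ≠ ℓ := by rintro rfl; exact hpD (dvd_mul_right p D')
        have hpD' : ¬ p ∣ D' := fun h ↦ hpD (h.mul_left ℓ)
        rw [hGp hp, if_neg hpℓ, hG'g p hp hpD']
      · -- `a_p(G) ≡ af p` on `D`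
        rw [hGp hp]
        by_cases hpℓ : p = ℓ
        · subst hpℓ
          rw [if_pos rfl, hafℓ]
          have : ι.symm ((u : ℂ) - (cuspCoeff G' p - β)) = -ι.symm (cuspCoeff G' p - β - u) := by
            rw [← map_neg]; congr 1; ring
          rw [this, Valuation.map_neg]
          exact hα
        · rw [if_neg hpℓ]
          have hpD' : p ∣ D' := by
            rcases (Nat.Prime.dvd_mul hp).mp hpD with h | h
            · exact absurd ((Nat.prime_dvd_prime_iff_eq hp hℓ).mp h) hpℓ
            · exact h
          exact hG'f p hp hpD'

end Induction

end Summit.BirchSwinnertonDyer.BirchSwinnertonDyer.Theorems.KimAtThreeDeepLowerOffStratumLevelLoweringMultiStabData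

end
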